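import Summits.ValiantsHypothesis.ValiantsHypothesis.Theorems.BarrierLeverChowStarveRows

/-!
# Route BarrierLever — item 20195 `ChowHitsThinRowPartitionMinors` is FALSE, II: truncated inverses
# and products of `y`-only polynomials without constant term

Helper file (`--supports stmt-ValiantsHypothesis-20195`; cell valiant-natproofs, rung V4, 𝒟-side;
seat val-np-p2 gen 9).  Closes NO item; definition-free.  Part of the kernel REFUTATION of items
20195 / 20172 / 20239 (memo HOME/val-np-p2/g9/REFUTATION-20195-valnp2-g9.md, §2):

* `coeff_leaveOneOut_eq_tinv` / `coeff_leaveTwoOut_eq_tinv` — on squarefree monomials the leave-out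
  products `∏_{j ∉ S} λ_j` (`|S| ≤ 2`) of the `y`-parts `λ_j = 1 + Σ_c B j c · y_c` equal
  `(∏_j λ_j) · ∏_{k∈S} t_k` with the truncated inverses `t_k` of `…ChowCubeThetaHat`;
* `coeff_mul_of_noConst`, `…_card_le_one`, `…_card_two`, `…_card_three` — coefficients of a product
  of two `y`-only polynomials with zero constant term on sets of size `≤ 3`;
* `coeff_tinv_sub_one`, `support_tinv_sub_one` — `t_k - 1` has no constant term and is `y`-only.

WHAT THIS IS NOT: bookkeeping; nothing on item 19717, on crux stmt-ValiantsHypothesis-14610, or on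
`VP` versus `VNP`.
-/

set_option linter.dupNamespace false

namespace Summit.ValiantsHypothesis.ValiantsHypothesis.Theorems.BarrierLever.ChowStarve

open Finset MvPolynomial
open Summit.ValiantsHypothesis.ValiantsHypothesis.Theorems.BarrierLever.ChowFactor
  (coeff_partitionExpo_mul_yOnly support_castAdd_eq_zero_of_vars)
open Summit.ValiantsHypothesis.ValiantsHypothesis.Theorems.BarrierLever.ChowCube
  (coeff_tinv coeff_mul_tinv_mul_affineY castAdd_notMem_vars_tinv)
open Summit.ValiantsHypothesis.ValiantsHypothesis.Theorems.BarrierLever.CorankRepair (partitionExpo_eq_iff)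

variable {h : ℕ}

/-! ## 1. Leave-out products as truncated inverses -/

/-- `coeff (E ∅ T) (∏_{j ≠ k} λ_j) = coeff (E ∅ T) ((∏_j λ_j) · t_k)` with the truncated inverse `t_k`. -/
theorem coeff_leaveOneOut_eq_tinv (B : Fin (h + h) → Fin h → ℂ) (k : Fin (h + h)) (T : Finset (Fin h)) :
    coeff (∑ a ∈ (∅ : Finset (Fin h)), Finsupp.single (Fin.castAdd h a) 1 +
        ∑ c ∈ T, Finsupp.single (Fin.natAdd h c) 1)
        (∏ j ∈ Finset.univ.erase k, ((1 + ∑ c, C (B j c) * X (Fin.natAdd h c)) :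
          MvPolynomial (Fin (h + h)) ℂ)) =
      coeff (∑ a ∈ (∅ : Finset (Fin h)), Finsupp.single (Fin.castAdd h a) 1 +
          ∑ c ∈ T, Finsupp.single (Fin.natAdd h c) 1)
        ((∏ j, ((1 + ∑ c, C (B j c) * X (Fin.natAdd h c)) : MvPolynomial (Fin (h + h)) ℂ)) *
          ∑ S ∈ (Finset.univ : Finset (Fin h)).powerset,
            monomial (∑ a ∈ (∅ : Finset (Fin h)), Finsupp.single (Fin.castAdd h a) 1 +
              ∑ c ∈ S, Finsupp.single (Fin.natAdd h c) 1)
              ((-1 : ℂ) ^ S.card * (S.card.factorial : ℂ) * ∏ c ∈ S, B k c)) := by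
  classical
  rw [← coeff_mul_tinv_mul_affineY (∏ j ∈ Finset.univ.erase k,
      ((1 + ∑ c, C (B j c) * X (Fin.natAdd h c)) : MvPolynomial (Fin (h + h)) ℂ)) (B k) ∅ T]
  congr 1
  rw [mul_comm (∑ S ∈ (Finset.univ : Finset (Fin h)).powerset, _) _, ← mul_assoc,
    Finset.prod_erase_mul _ _ (Finset.mem_univ k)]

/-- `coeff (E ∅ T) (∏_{j ≠ k, k'} λ_j) = coeff (E ∅ T) ((∏_j λ_j) · (t_k · t_{k'}))` for `k' ≠ k`. -/
theorem coeff_leaveTwoOut_eq_tinv (B : Fin (h + h) → Fin h → ℂ) (k k' : Fin (h + h)) (hk' : k' ≠ k)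
    (T : Finset (Fin h)) :
    coeff (∑ a ∈ (∅ : Finset (Fin h)), Finsupp.single (Fin.castAdd h a) 1 +
        ∑ c ∈ T, Finsupp.single (Fin.natAdd h c) 1)
        (∏ j ∈ (Finset.univ.erase k).erase k', ((1 + ∑ c, C (B j c) * X (Fin.natAdd h c)) :
          MvPolynomial (Fin (h + h)) ℂ)) =
      coeff (∑ a ∈ (∅ : Finset (Fin h)), Finsupp.single (Fin.castAdd h a) 1 +
          ∑ c ∈ T, Finsupp.single (Fin.natAdd h c) 1)
        ((∏ j, ((1 + ∑ c, C (B j c) * X (Fin.natAdd h c)) : MvPolynomial (Fin (h + h)) ℂ)) *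
          ((∑ S ∈ (Finset.univ : Finset (Fin h)).powerset,
            monomial (∑ a ∈ (∅ : Finset (Fin h)), Finsupp.single (Fin.castAdd h a) 1 +
              ∑ c ∈ S, Finsupp.single (Fin.natAdd h c) 1)
              ((-1 : ℂ) ^ S.card * (S.card.factorial : ℂ) * ∏ c ∈ S, B k c)) *
          (∑ S ∈ (Finset.univ : Finset (Fin h)).powerset,
            monomial (∑ a ∈ (∅ : Finset (Fin h)), Finsupp.single (Fin.castAdd h a) 1 +
              ∑ c ∈ S, Finsupp.single (Fin.natAdd h c) 1)
              ((-1 : ℂ) ^ S.card * (S.card.factorial : ℂ) * ∏ c ∈ S, B k' c)))) := by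
  classical
  have hmem : k' ∈ Finset.univ.erase k := Finset.mem_erase.mpr ⟨hk', Finset.mem_univ k'⟩
  rw [← coeff_mul_tinv_mul_affineY (∏ j ∈ (Finset.univ.erase k).erase k',
      ((1 + ∑ c, C (B j c) * X (Fin.natAdd h c)) : MvPolynomial (Fin (h + h)) ℂ)) (B k') ∅ T]
  rw [mul_comm (∑ S ∈ (Finset.univ : Finset (Fin h)).powerset, _) _, ← mul_assoc,
    Finset.prod_erase_mul _ _ hmem]
  set P := ∏ j ∈ Finset.univ.erase k, ((1 + ∑ c, C (B j c) * X (Fin.natAdd h c)) :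
    MvPolynomial (Fin (h + h)) ℂ) with hP
  set tk := ∑ S ∈ (Finset.univ : Finset (Fin h)).powerset,
    monomial (∑ a ∈ (∅ : Finset (Fin h)), Finsupp.single (Fin.castAdd h a) 1 +
      ∑ c ∈ S, Finsupp.single (Fin.natAdd h c) 1)
      ((-1 : ℂ) ^ S.card * (S.card.factorial : ℂ) * ∏ c ∈ S, B k c) with htk
  set tk' := ∑ S ∈ (Finset.univ : Finset (Fin h)).powerset,
    monomial (∑ a ∈ (∅ : Finset (Fin h)), Finsupp.single (Fin.castAdd h a) 1 +
      ∑ c ∈ S, Finsupp.single (Fin.natAdd h c) 1)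
      ((-1 : ℂ) ^ S.card * (S.card.factorial : ℂ) * ∏ c ∈ S, B k' c) with htk'
  set lk := ((1 + ∑ c, C (B k c) * X (Fin.natAdd h c)) : MvPolynomial (Fin (h + h)) ℂ) with hlk
  have hPl : P * lk = ∏ j, ((1 + ∑ c, C (B j c) * X (Fin.natAdd h c)) : MvPolynomial (Fin (h + h)) ℂ) :=
    Finset.prod_erase_mul _ _ (Finset.mem_univ k)
  rw [← coeff_mul_tinv_mul_affineY (P * tk') (B k) ∅ T]
  rw [← htk, ← hlk, show P * tk' * (tk * lk) = (P * lk) * (tk * tk') by ring, hPl]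

/-! ## 2. Products of two `y`-only polynomials without constant term, in degrees `≤ 3` -/

/-- The exponent `E ∅ e` is `0` iff `e = ∅`. -/
theorem partitionExpo_empty_eq_zero_iff (e : Finset (Fin h)) :
    ((∑ a ∈ (∅ : Finset (Fin h)), Finsupp.single (Fin.castAdd h a) 1 +
        ∑ c ∈ e, Finsupp.single (Fin.natAdd h c) 1 : Fin (h + h) →₀ ℕ) = 0) ↔ e = ∅ := by
  constructor
  · intro he
    have h2 : ((∑ a ∈ (∅ : Finset (Fin h)), Finsupp.single (Fin.castAdd h a) 1 +
        ∑ c ∈ e, Finsupp.single (Fin.natAdd h c) 1 : Fin (h + h) →₀ ℕ)) =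
        ∑ a ∈ (∅ : Finset (Fin h)), Finsupp.single (Fin.castAdd h a) 1 +
          ∑ c ∈ (∅ : Finset (Fin h)), Finsupp.single (Fin.natAdd h c) 1 := by
      rw [he]; simp
    exact ((partitionExpo_eq_iff ∅ e ∅ ∅).mp h2).2
  · rintro rfl; simp

/-- **Products of two `y`-only polynomials with zero constant term** have no coefficients on sets of
size `≤ 1`, and explicit ones on sets of size `2` and `3`. -/
theorem coeff_mul_of_noConst (P Q : MvPolynomial (Fin (h + h)) ℂ)
    (hQ : ∀ s ∈ Q.support, ∀ a : Fin h, s (Fin.castAdd h a) = 0)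
    (hP0 : coeff (∑ a ∈ (∅ : Finset (Fin h)), Finsupp.single (Fin.castAdd h a) 1 +
        ∑ c ∈ (∅ : Finset (Fin h)), Finsupp.single (Fin.natAdd h c) 1) P = 0)
    (hQ0 : coeff (∑ a ∈ (∅ : Finset (Fin h)), Finsupp.single (Fin.castAdd h a) 1 +
        ∑ c ∈ (∅ : Finset (Fin h)), Finsupp.single (Fin.natAdd h c) 1) Q = 0)
    (d : Finset (Fin h)) :
    coeff (∑ a ∈ (∅ : Finset (Fin h)), Finsupp.single (Fin.castAdd h a) 1 +
        ∑ c ∈ d, Finsupp.single (Fin.natAdd h c) 1) (P * Q) =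
      ∑ d' ∈ d.powerset with d' ≠ ∅ ∧ d' ≠ d,
        coeff (∑ a ∈ (∅ : Finset (Fin h)), Finsupp.single (Fin.castAdd h a) 1 +
            ∑ c ∈ d \ d', Finsupp.single (Fin.natAdd h c) 1) P *
          coeff (∑ a ∈ (∅ : Finset (Fin h)), Finsupp.single (Fin.castAdd h a) 1 +
            ∑ c ∈ d', Finsupp.single (Fin.natAdd h c) 1) Q := by
  classical
  rw [coeff_partitionExpo_mul_yOnly P Q hQ ∅ d, Finset.sum_filter]
  refine Finset.sum_congr rfl fun d' hd' => ?_
  by_cases h1 : d' ≠ ∅ ∧ d' ≠ d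
  · rw [if_pos h1]
  · rw [if_neg h1]
    rw [not_and_or, not_not, not_not] at h1
    rcases h1 with rfl | rfl
    · rw [hQ0, mul_zero]
    · rw [Finset.sdiff_self, hP0, zero_mul]

/-- Sets of size `≤ 1` have no proper nonempty subset: the product has zero coefficient there. -/
theorem coeff_mul_of_noConst_card_le_one (P Q : MvPolynomial (Fin (h + h)) ℂ)
    (hQ : ∀ s ∈ Q.support, ∀ a : Fin h, s (Fin.castAdd h a) = 0)
    (hP0 : coeff (∑ a ∈ (∅ : Finset (Fin h)), Finsupp.single (Fin.castAdd h a) 1 +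
        ∑ c ∈ (∅ : Finset (Fin h)), Finsupp.single (Fin.natAdd h c) 1) P = 0)
    (hQ0 : coeff (∑ a ∈ (∅ : Finset (Fin h)), Finsupp.single (Fin.castAdd h a) 1 +
        ∑ c ∈ (∅ : Finset (Fin h)), Finsupp.single (Fin.natAdd h c) 1) Q = 0)
    (d : Finset (Fin h)) (hd : d.card ≤ 1) :
    coeff (∑ a ∈ (∅ : Finset (Fin h)), Finsupp.single (Fin.castAdd h a) 1 +
        ∑ c ∈ d, Finsupp.single (Fin.natAdd h c) 1) (P * Q) = 0 := by
  classical
  rw [coeff_mul_of_noConst P Q hQ hP0 hQ0 d]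
  refine Finset.sum_eq_zero fun d' hd' => ?_
  exfalso
  rw [Finset.mem_filter, Finset.mem_powerset] at hd'
  obtain ⟨hsub, hne, hned⟩ := hd'
  have h1 : 0 < d'.card := Finset.card_pos.mpr (Finset.nonempty_iff_ne_empty.mpr hne)
  have h2 : d'.card < d.card := Finset.card_lt_card (lt_of_le_of_ne hsub hned)
  omega

/-- On a set of size `2` the coefficient of the product is `Σ_{c ∈ d} P_{d ∖ c} · Q_{c}`. -/
theorem coeff_mul_of_noConst_card_two (P Q : MvPolynomial (Fin (h + h)) ℂ)
    (hQ : ∀ s ∈ Q.support, ∀ a : Fin h, s (Fin.castAdd h a) = 0)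
    (hP0 : coeff (∑ a ∈ (∅ : Finset (Fin h)), Finsupp.single (Fin.castAdd h a) 1 +
        ∑ c ∈ (∅ : Finset (Fin h)), Finsupp.single (Fin.natAdd h c) 1) P = 0)
    (hQ0 : coeff (∑ a ∈ (∅ : Finset (Fin h)), Finsupp.single (Fin.castAdd h a) 1 +
        ∑ c ∈ (∅ : Finset (Fin h)), Finsupp.single (Fin.natAdd h c) 1) Q = 0)
    (d : Finset (Fin h)) (hd : d.card = 2) :
    coeff (∑ a ∈ (∅ : Finset (Fin h)), Finsupp.single (Fin.castAdd h a) 1 +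
        ∑ c ∈ d, Finsupp.single (Fin.natAdd h c) 1) (P * Q) =
      ∑ c ∈ d, coeff (∑ a ∈ (∅ : Finset (Fin h)), Finsupp.single (Fin.castAdd h a) 1 +
            ∑ c' ∈ d.erase c, Finsupp.single (Fin.natAdd h c') 1) P *
          coeff (∑ a ∈ (∅ : Finset (Fin h)), Finsupp.single (Fin.castAdd h a) 1 +
            ∑ c' ∈ ({c} : Finset (Fin h)), Finsupp.single (Fin.natAdd h c') 1) Q := by
  classical
  rw [coeff_mul_of_noConst P Q hQ hP0 hQ0 d]
  -- the proper nonempty subsets of a 2-set are its singletons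
  have hfilt : (d.powerset.filter fun d' => d' ≠ ∅ ∧ d' ≠ d) = d.powersetCard 1 := by
    ext d'
    rw [Finset.mem_filter, Finset.mem_powerset, Finset.mem_powersetCard]
    constructor
    · rintro ⟨hsub, hne, hned⟩
      refine ⟨hsub, ?_⟩
      have h1 : 0 < d'.card := Finset.card_pos.mpr (Finset.nonempty_iff_ne_empty.mpr hne)
      have h2 : d'.card < d.card := Finset.card_lt_card (lt_of_le_of_ne hsub hned)
      omega
    · rintro ⟨hsub, hcard⟩
      refine ⟨hsub, ?_, ?_⟩
      · intro he; rw [he, Finset.card_empty] at hcard; exact zero_ne_one hcard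
      · intro he; rw [he] at hcard; omega
  rw [hfilt, Finset.powersetCard_one, Finset.sum_map]
  refine Finset.sum_congr rfl fun c _ => ?_
  simp only [Function.Embedding.coeFn_mk, Finset.sdiff_singleton_eq_erase]

/-- On a set of size `3` the coefficient of the product is
`Σ_{c ∈ d} (P_{d ∖ c} · Q_{c} + P_{c} · Q_{d ∖ c})`. -/
theorem coeff_mul_of_noConst_card_three (P Q : MvPolynomial (Fin (h + h)) ℂ)
    (hQ : ∀ s ∈ Q.support, ∀ a : Fin h, s (Fin.castAdd h a) = 0)
    (hP0 : coeff (∑ a ∈ (∅ : Finset (Fin h)), Finsupp.single (Fin.castAdd h a) 1 +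
        ∑ c ∈ (∅ : Finset (Fin h)), Finsupp.single (Fin.natAdd h c) 1) P = 0)
    (hQ0 : coeff (∑ a ∈ (∅ : Finset (Fin h)), Finsupp.single (Fin.castAdd h a) 1 +
        ∑ c ∈ (∅ : Finset (Fin h)), Finsupp.single (Fin.natAdd h c) 1) Q = 0)
    (d : Finset (Fin h)) (hd : d.card = 3) :
    coeff (∑ a ∈ (∅ : Finset (Fin h)), Finsupp.single (Fin.castAdd h a) 1 +
        ∑ c ∈ d, Finsupp.single (Fin.natAdd h c) 1) (P * Q) =
      ∑ c ∈ d, (coeff (∑ a ∈ (∅ : Finset (Fin h)), Finsupp.single (Fin.castAdd h a) 1 +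
            ∑ c' ∈ d.erase c, Finsupp.single (Fin.natAdd h c') 1) P *
          coeff (∑ a ∈ (∅ : Finset (Fin h)), Finsupp.single (Fin.castAdd h a) 1 +
            ∑ c' ∈ ({c} : Finset (Fin h)), Finsupp.single (Fin.natAdd h c') 1) Q +
        coeff (∑ a ∈ (∅ : Finset (Fin h)), Finsupp.single (Fin.castAdd h a) 1 +
            ∑ c' ∈ ({c} : Finset (Fin h)), Finsupp.single (Fin.natAdd h c') 1) P *
          coeff (∑ a ∈ (∅ : Finset (Fin h)), Finsupp.single (Fin.castAdd h a) 1 +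
            ∑ c' ∈ d.erase c, Finsupp.single (Fin.natAdd h c') 1) Q) := by
  classical
  rw [coeff_mul_of_noConst P Q hQ hP0 hQ0 d]
  -- the proper nonempty subsets of a 3-set: singletons and complements of singletons
  have hfilt : (d.powerset.filter fun d' => d' ≠ ∅ ∧ d' ≠ d) = d.powersetCard 1 ∪ d.powersetCard 2 := by
    ext d'
    rw [Finset.mem_union, Finset.mem_filter, Finset.mem_powerset, Finset.mem_powersetCard,
      Finset.mem_powersetCard]
    constructor
    · rintro ⟨hsub, hne, hned⟩
      have h1 : 0 < d'.card := Finset.card_pos.mpr (Finset.nonempty_iff_ne_empty.mpr hne)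
      have h2 : d'.card < d.card := Finset.card_lt_card (lt_of_le_of_ne hsub hned)
      rcases Nat.lt_or_ge d'.card 2 with h3 | h3
      · exact Or.inl ⟨hsub, by omega⟩
      · exact Or.inr ⟨hsub, by omega⟩
    · rintro (⟨hsub, hcard⟩ | ⟨hsub, hcard⟩)
      · refine ⟨hsub, ?_, ?_⟩
        · intro he; rw [he, Finset.card_empty] at hcard; exact zero_ne_one hcard
        · intro he; rw [he] at hcard; omega
      · refine ⟨hsub, ?_, ?_⟩
        · intro he; rw [he, Finset.card_empty] at hcard; omega
        · intro he; rw [he] at hcard; omega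
  have hdisj : Disjoint (d.powersetCard 1) (d.powersetCard 2) :=
    Finset.pairwise_disjoint_powersetCard d (by norm_num)
  rw [hfilt, Finset.sum_union hdisj, Finset.sum_add_distrib]
  congr 1
  · rw [Finset.powersetCard_one, Finset.sum_map]
    refine Finset.sum_congr rfl fun c _ => ?_
    simp only [Function.Embedding.coeFn_mk, Finset.sdiff_singleton_eq_erase]
  · -- complements of singletons: reindex `powersetCard 2 d` by `c ↦ d.erase c`
    have himg : d.powersetCard 2 = d.image fun c => d.erase c := by
      ext d'
      rw [Finset.mem_powersetCard, Finset.mem_image]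
      constructor
      · rintro ⟨hsub, hcard⟩
        have hc1 : (d \ d').card = 1 := by rw [Finset.card_sdiff_of_subset hsub]; omega
        obtain ⟨c, hc⟩ := Finset.card_eq_one.mp hc1
        have hcd : c ∈ d \ d' := by rw [hc]; exact Finset.mem_singleton_self c
        refine ⟨c, (Finset.mem_sdiff.mp hcd).1, ?_⟩
        rw [← Finset.sdiff_singleton_eq_erase, ← hc, Finset.sdiff_sdiff_eq_self hsub]
      · rintro ⟨c, hc, rfl⟩
        exact ⟨Finset.erase_subset c d, by rw [Finset.card_erase_of_mem hc, hd]⟩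
    rw [himg, Finset.sum_image (fun c hc c' hc' e => Finset.erase_injOn d hc hc' e)]
    refine Finset.sum_congr rfl fun c hc => ?_
    have hsd : d \ d.erase c = {c} := by
      rw [Finset.sdiff_erase hc, Finset.sdiff_self, Finset.insert_empty]
    rw [hsd]


/-! ## 3. The truncated inverse minus one -/

/-- `coeff (E ∅ e) (t_k - 1) = 0` for `e = ∅` and `(-1)^|e| |e|! ∏_{c∈e} B k c` otherwise. -/
theorem coeff_tinv_sub_one (b : Fin h → ℂ) (e : Finset (Fin h)) :
    coeff (∑ a ∈ (∅ : Finset (Fin h)), Finsupp.single (Fin.castAdd h a) 1 + ∑ c ∈ e, Finsupp.single (Fin.natAdd h c) 1)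
        ((∑ S ∈ (Finset.univ : Finset (Fin h)).powerset,
            monomial (∑ a ∈ (∅ : Finset (Fin h)), Finsupp.single (Fin.castAdd h a) 1 +
              ∑ c ∈ S, Finsupp.single (Fin.natAdd h c) 1)
              ((-1 : ℂ) ^ S.card * (S.card.factorial : ℂ) * ∏ c ∈ S, b c)) - 1) =
      if e = ∅ then 0 else (-1 : ℂ) ^ e.card * (e.card.factorial : ℂ) * ∏ c ∈ e, b c := by
  classical
  rw [coeff_sub, coeff_tinv, coeff_one]
  by_cases he : e = ∅
  · subst he
    rw [if_pos ((partitionExpo_empty_eq_zero_iff (∅ : Finset (Fin h))).mpr rfl).symm, if_pos rfl]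
    simp
  · rw [if_neg (fun h0 => he ((partitionExpo_empty_eq_zero_iff e).mp h0.symm)), if_neg he, sub_zero]

/-- `t_k - 1` is `y`-only. -/
theorem support_tinv_sub_one (b : Fin h → ℂ) :
    ∀ s ∈ ((∑ S ∈ (Finset.univ : Finset (Fin h)).powerset,
            monomial (∑ a ∈ (∅ : Finset (Fin h)), Finsupp.single (Fin.castAdd h a) 1 +
              ∑ c ∈ S, Finsupp.single (Fin.natAdd h c) 1)
              ((-1 : ℂ) ^ S.card * (S.card.factorial : ℂ) * ∏ c ∈ S, b c)) - 1 :
          MvPolynomial (Fin (h + h)) ℂ).support, ∀ a : Fin h, s (Fin.castAdd h a) = 0 := by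
  classical
  refine support_castAdd_eq_zero_of_vars _ fun a ha => ?_
  have h1 : Fin.castAdd h a ∈ _ ∪ (1 : MvPolynomial (Fin (h + h)) ℂ).vars := vars_sub_subset _ ha
  rw [vars_one, Finset.union_empty] at h1
  exact castAdd_notMem_vars_tinv b a h1

end Summit.ValiantsHypothesis.ValiantsHypothesis.Theorems.BarrierLever.ChowStarve
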